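import Summits.ValiantsHypothesis.ValiantsHypothesis.Theorems.KPlusLogSqLawValuativeDoorSidonTwo
import Summits.ValiantsHypothesis.ValiantsHypothesis.Theorems.KPlusLogSqLawValuativeDoorGenTwoGram

/-!
# LINE `valuative_door` (crux `WeakLifting`, stmt-ValiantsHypothesis-19561) — the WIDTH-TWO GENERAL ROW on Sidon supports:
# a general `2 × 2` lacunary pencil with `K ≥ 4` letters on a Sidon support has `npEdges ≤ 5K − 11`

HONEST FRAMING.  Helper (cell `pub-symmetroid`, seat val-sym-lift-p1 g23, 2026-08-29; `--supports 19561 --as helper`).  The general-letter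
companion of `…ValuativeDoorSidonTwo` (VERDICT #54 (a2): the honest object of the line is the general lacunary pencil = a width-two lacunary
ABP).  For general `2 × 2` letters the polarised determinant has rank FOUR, so the obstruction needs SIX letters and a NON-PRINCIPAL `5 × 5`
Gram minor (rows = the five smallest, columns = the five largest letters): with `d i₀ < … < d i₅` the three mutually nested pair exponents
`d i₀ + d i₅`, `d i₁ + d i₄`, `d i₂ + d i₃` are never ALL dominant (`not_three_nested_dominant_gen_of_sidon`; roof of the three dominance
lines `…GenTwoGram.min3_affine_outer_le_inner`, weak two-slope rearrangement `…NestedPairs.sum_perm_le_sum_rev`, Gram identity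
`…GenTwoGram.det_gram_polarDet2_eq_zero`).  Hence the dominant off-diagonal pairs contain no three pairwise nested ones: the minimal ones and
the rest are two chains, the second of gap `≥ 3` (`card_le_of_noThreeNested`: `≤ (2K − 3) + (2K − 7)`), plus `K` diagonal exponents:
`npEdges ≤ 5K − 11` for `K ≥ 4` (`valGenSidonTwo_unfolded`; `K ≤ 5`: equal to the trivial `K(K+1)/2 − 1` of `…Sectors`, content from
`K = 6` on).  Two nested dominant pairs DO occur for general letters (located), so the symmetric `3K − 4` does not transfer verbatim.
Calibration only (`m = 2`, Sidon supports, sharpness not claimed); no bearing on vW / vB, `TropicalB`, `MatrixDescartes` (18050) or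
VP ≠ VNP.  [elementary]
-/

set_option linter.dupNamespace false
set_option autoImplicit false

namespace Summit.ValiantsHypothesis.ValiantsHypothesis.Theorems.KPlusLogSqLaw.ValDoor

open Polynomial Finset Matrix
open scoped BigOperators Classical

variable {F : Type*} [Field F]

/-! ## §1 Three mutually nested pairs are never all dominant (general letters) -/

/-- **THREE NESTED PAIRS ARE NEVER ALL DOMINANT (general `2 × 2` letters).**  For a `2 × 2` lacunary pencil on a Sidon support and six
letters with `d i₀ < d i₁ < d i₂ < d i₃ < d i₄ < d i₅`, the pair exponents `d i₀ + d i₅`, `d i₁ + d i₄`, `d i₂ + d i₃` are not all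
dominant, for any non-archimedean `v`. [rank-four Gram obstruction on the non-principal minor rows `i₀..i₄` × columns `i₁..i₅`] -/
theorem not_three_nested_dominant_gen_of_sidon (v : AbsoluteValue F ℝ) (hv : IsNonarchimedean v) {K : ℕ} (d : Fin K → ℕ)
    (M : Fin K → Matrix (Fin 2) (Fin 2) F)
    (hsid : ∀ l₁ l₂ l₃ l₄ : Fin K, d l₁ + d l₂ = d l₃ + d l₄ → (l₁ = l₃ ∧ l₂ = l₄) ∨ (l₁ = l₄ ∧ l₂ = l₃))
    {i₀ i₁ i₂ i₃ i₄ i₅ : Fin K} (h01 : d i₀ < d i₁) (h12 : d i₁ < d i₂) (h23 : d i₂ < d i₃) (h34 : d i₃ < d i₄) (h45 : d i₄ < d i₅)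
    (hdom : ∀ E ∈ ({d i₀ + d i₅, d i₁ + d i₄, d i₂ + d i₃} : Finset ℕ),
      E ∈ (Matrix.det (∑ l, ((X : F[X]) ^ d l) • (M l).map (C : F →+* F[X]))).support ∧
      ∃ r : ℝ, 0 < r ∧ ∀ E' ∈ (Matrix.det (∑ l, ((X : F[X]) ^ d l) • (M l).map (C : F →+* F[X]))).support, E' ≠ E →
        v ((Matrix.det (∑ l, ((X : F[X]) ^ d l) • (M l).map (C : F →+* F[X]))).coeff E') * r ^ E'
          < v ((Matrix.det (∑ l, ((X : F[X]) ^ d l) • (M l).map (C : F →+* F[X]))).coeff E) * r ^ E) :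
    False := by
  set f : F[X] := Matrix.det (∑ l, ((X : F[X]) ^ d l) • (M l).map (C : F →+* F[X])) with hf
  -- the six letters, rows `ι r = e r.castSucc` (five smallest), columns `κ c = e c.succ` (five largest)
  set e : Fin 6 → Fin K := ![i₀, i₁, i₂, i₃, i₄, i₅] with he
  have he0 : e 0 = i₀ := rfl
  have he1 : e 1 = i₁ := rfl
  have he2 : e 2 = i₂ := rfl
  have he3 : e 3 = i₃ := rfl
  have he4 : e 4 = i₄ := rfl
  have he5 : e 5 = i₅ := rfl
  have hmono : StrictMono (d ∘ e) := by
    refine Fin.strictMono_iff_lt_succ.2 fun i => ?_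
    fin_cases i
    · exact h01
    · exact h12
    · exact h23
    · exact h34
    · exact h45
  have heinj : Function.Injective e := fun i j hij => hmono.injective (by simp only [Function.comp_apply, hij])
  set ι : Fin 5 → Fin K := fun r => e r.castSucc with hι
  set κ : Fin 5 → Fin K := fun c => e c.succ with hκ
  have hιmono : StrictMono (d ∘ ι) := fun r r' h => hmono (Fin.castSucc_lt_castSucc_iff.2 h)
  have hκmono : StrictMono (d ∘ κ) := fun c c' h => hmono (Fin.succ_lt_succ_iff.2 h)
  -- the three nested exponents
  set B₀ : ℕ := d i₀ + d i₅ with hB₀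
  set B₁ : ℕ := d i₁ + d i₄ with hB₁
  set B₂ : ℕ := d i₂ + d i₃ with hB₂
  have hd0 := hdom B₀ (by simp [hB₀])
  have hd1 := hdom B₁ (by simp [hB₁])
  have hd2 := hdom B₂ (by simp [hB₂])
  -- Sidon bookkeeping: an entry exponent equal to a nested exponent sits on the reversal
  have hsum_rev : ∀ r c : Fin 5, (d (ι r) + d (κ c) = B₀ ∨ d (ι r) + d (κ c) = B₁ ∨ d (ι r) + d (κ c) = B₂) → r = Fin.revPerm c := by
    intro r c h
    simp only [hι, hκ] at h
    have key : ∀ u w : Fin 6, d (e r.castSucc) + d (e c.succ) = d (e u) + d (e w) →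
        (r.val = u.val ∧ c.val + 1 = w.val) ∨ (r.val = w.val ∧ c.val + 1 = u.val) := by
      intro u w huw
      rcases hsid _ _ _ _ huw with ⟨h1, h2⟩ | ⟨h1, h2⟩
      · left
        exact ⟨by simpa using congrArg Fin.val (heinj h1), by simpa using congrArg Fin.val (heinj h2)⟩
      · right
        exact ⟨by simpa using congrArg Fin.val (heinj h1), by simpa using congrArg Fin.val (heinj h2)⟩
    apply Fin.ext
    rw [Fin.revPerm_apply, Fin.val_rev]
    have hr := r.isLt
    have hc := c.isLt
    rcases h with h | h | h
    · rw [hB₀, ← he0, ← he5] at h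
      rcases key 0 5 h with ⟨h1, h2⟩ | ⟨h1, h2⟩
      · simp at h1 h2; omega
      · simp at h1 h2
    · rw [hB₁, ← he1, ← he4] at h
      rcases key 1 4 h with ⟨h1, h2⟩ | ⟨h1, h2⟩
      · simp at h1 h2; omega
      · simp at h1 h2; omega
    · rw [hB₂, ← he2, ← he3] at h
      rcases key 2 3 h with ⟨h1, h2⟩ | ⟨h1, h2⟩
      · simp at h1 h2; omega
      · simp at h1 h2; omega
  have hrevB : ∀ c : Fin 5, d (ι (Fin.revPerm c)) + d (κ c) = B₀ ∨ d (ι (Fin.revPerm c)) + d (κ c) = B₁ ∨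
      d (ι (Fin.revPerm c)) + d (κ c) = B₂ := by
    intro c
    fin_cases c
    · right; left; show d (e (Fin.castSucc (Fin.rev 0))) + d (e (Fin.succ 0)) = B₁
      rw [show Fin.castSucc (Fin.rev (0 : Fin 5)) = (4 : Fin 6) from rfl, show Fin.succ (0 : Fin 5) = (1 : Fin 6) from rfl,
        he4, he1, hB₁, Nat.add_comm]
    · right; right; show d (e (Fin.castSucc (Fin.rev 1))) + d (e (Fin.succ 1)) = B₂
      rw [show Fin.castSucc (Fin.rev (1 : Fin 5)) = (3 : Fin 6) from rfl, show Fin.succ (1 : Fin 5) = (2 : Fin 6) from rfl,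
        he3, he2, hB₂, Nat.add_comm]
    · right; right; show d (e (Fin.castSucc (Fin.rev 2))) + d (e (Fin.succ 2)) = B₂
      rw [show Fin.castSucc (Fin.rev (2 : Fin 5)) = (2 : Fin 6) from rfl, show Fin.succ (2 : Fin 5) = (3 : Fin 6) from rfl, he2, he3]
    · right; left; show d (e (Fin.castSucc (Fin.rev 3))) + d (e (Fin.succ 3)) = B₁
      rw [show Fin.castSucc (Fin.rev (3 : Fin 5)) = (1 : Fin 6) from rfl, show Fin.succ (3 : Fin 5) = (4 : Fin 6) from rfl, he1, he4]
    · left; show d (e (Fin.castSucc (Fin.rev 4))) + d (e (Fin.succ 4)) = B₀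
      rw [show Fin.castSucc (Fin.rev (4 : Fin 5)) = (0 : Fin 6) from rfl, show Fin.succ (4 : Fin 5) = (5 : Fin 6) from rfl, he0, he5]
  have hrev_off : ∀ c : Fin 5, ι (Fin.revPerm c) ≠ κ c := by
    intro c h
    have h' := congrArg Fin.val (heinj h)
    simp only [Fin.val_castSucc, Fin.val_succ, Fin.revPerm_apply, Fin.val_rev] at h'
    omega
  -- the three dominance lines and their roof
  set ℓ : ℕ → ℝ := fun E => Real.log (v (f.coeff E)) with hℓ
  obtain ⟨s₀, hs₀⟩ := (exists_dominant_iff_exists_slope v f hd0.1).1 hd0.2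
  obtain ⟨s₁, hs₁⟩ := (exists_dominant_iff_exists_slope v f hd1.1).1 hd1.2
  obtain ⟨s₂, hs₂⟩ := (exists_dominant_iff_exists_slope v f hd2.1).1 hd2.2
  set h : ℝ → ℝ := fun t => min (min (ℓ B₀ + (B₀ : ℝ) * s₀ + (-s₀) * t) (ℓ B₁ + (B₁ : ℝ) * s₁ + (-s₁) * t))
    (ℓ B₂ + (B₂ : ℝ) * s₂ + (-s₂) * t) with hh
  have hline : ∀ (E : ℕ) (Bi : ℕ) (si : ℝ), (∀ E' ∈ f.support, E' ≠ Bi → ℓ E' + E' * si < ℓ Bi + Bi * si) →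
      E ∈ f.support → ℓ E ≤ ℓ Bi + (Bi : ℝ) * si + (-si) * E := by
    intro E Bi si hsi hE
    by_cases hEB : E = Bi
    · rw [hEB]; linarith
    · have := hsi E hE hEB; linarith
  have hmaj : ∀ E ∈ f.support, ℓ E ≤ h E := fun E hE =>
    le_min (le_min (hline E B₀ s₀ hs₀ hE) (hline E B₁ s₁ hs₁ hE)) (hline E B₂ s₂ hs₂ hE)
  have hmaj_lt : ∀ E ∈ f.support, E ≠ B₀ → E ≠ B₁ → E ≠ B₂ → ℓ E < h E := by
    intro E hE h0 h1 h2
    refine lt_min (lt_min ?_ ?_) ?_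
    · have := hs₀ E hE h0; linarith
    · have := hs₁ E hE h1; linarith
    · have := hs₂ E hE h2; linarith
  have hhB0 : h B₀ = ℓ B₀ :=
    le_antisymm (((min_le_left _ _).trans (min_le_left _ _)).trans (by linarith)) (hmaj B₀ hd0.1)
  have hhB1 : h B₁ = ℓ B₁ :=
    le_antisymm (((min_le_left _ _).trans (min_le_right _ _)).trans (by linarith)) (hmaj B₁ hd1.1)
  have hhB2 : h B₂ = ℓ B₂ := le_antisymm ((min_le_right _ _).trans (by linarith)) (hmaj B₂ hd2.1)
  have hhrev : ∀ c : Fin 5, h (d (ι (Fin.revPerm c)) + d (κ c) : ℕ) = ℓ (d (ι (Fin.revPerm c)) + d (κ c)) := by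
    intro c
    rcases hrevB c with h0 | h0 | h0 <;> rw [h0]
    · exact hhB0
    · exact hhB1
    · exact hhB2
  have hrev_supp : ∀ c : Fin 5, (d (ι (Fin.revPerm c)) + d (κ c)) ∈ f.support := by
    intro c
    rcases hrevB c with h0 | h0 | h0 <;> rw [h0]
    · exact hd0.1
    · exact hd1.1
    · exact hd2.1
  -- the non-principal Gram minor (rows ι, columns κ)
  set N : Matrix (Fin 5) (Fin 5) F := Matrix.of fun r c : Fin 5 =>
    M (ι r) 0 0 * M (κ c) 1 1 + M (κ c) 0 0 * M (ι r) 1 1 - M (ι r) 0 1 * M (κ c) 1 0 - M (κ c) 0 1 * M (ι r) 1 0 with hN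
  have hdet : N.det = 0 :=
    det_gram_polarDet2_eq_zero (fun r => M (ι r) 0 0) (fun r => M (ι r) 0 1) (fun r => M (ι r) 1 0) (fun r => M (ι r) 1 1)
      (fun c => M (κ c) 0 0) (fun c => M (κ c) 0 1) (fun c => M (κ c) 1 0) (fun c => M (κ c) 1 1)
  -- every nonzero entry sits under the roof
  have hent : ∀ r c, N r c ≠ 0 → (d (ι r) + d (κ c)) ∈ f.support ∧ Real.log (v (N r c)) ≤ ℓ (d (ι r) + d (κ c)) := by
    intro r c hne
    by_cases hrc : ι r = κ c
    · have hNrc : N r c = 2 * f.coeff (d (ι r) + d (κ c)) := by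
        rw [hN, Matrix.of_apply, hrc, hf, coeff_diag_gen_of_sidon d M hsid (κ c)]
        ring
      rw [hNrc] at hne ⊢
      have hc : f.coeff (d (ι r) + d (κ c)) ≠ 0 := fun h0 => hne (by rw [h0, mul_zero])
      have h2 : (2 : F) ≠ 0 := fun h0 => hne (by rw [h0, zero_mul])
      refine ⟨Polynomial.mem_support_iff.2 hc, ?_⟩
      rw [map_mul, Real.log_mul (v.ne_zero h2) (v.ne_zero hc)]
      have : Real.log (v 2) ≤ 0 := Real.log_nonpos (v.nonneg _) (abv_two_le_one v hv)
      show Real.log (v 2) + Real.log (v (f.coeff (d (ι r) + d (κ c)))) ≤ ℓ (d (ι r) + d (κ c))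
      simp only [hℓ]
      linarith
    · have hNrc : N r c = f.coeff (d (ι r) + d (κ c)) := by
        rw [hN, Matrix.of_apply, hf, coeff_offdiag_gen_of_sidon d M hsid hrc]
      rw [hNrc] at hne ⊢
      exact ⟨Polynomial.mem_support_iff.2 hne, le_rfl⟩
  -- the roof table (first index = column, second = row) and its weak concavity along equal sums
  set x : Fin 5 → Fin 5 → ℝ := fun c r => h ((d (ι r) + d (κ c) : ℕ) : ℝ) with hx
  have hconc : ∀ p₁ q₁ p₂ q₂ p₃ q₃ p₄ q₄ : Fin 5,
      (d ∘ κ) p₁ + (d ∘ ι) q₁ + ((d ∘ κ) p₄ + (d ∘ ι) q₄) = (d ∘ κ) p₂ + (d ∘ ι) q₂ + ((d ∘ κ) p₃ + (d ∘ ι) q₃) →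
      (d ∘ κ) p₁ + (d ∘ ι) q₁ < (d ∘ κ) p₂ + (d ∘ ι) q₂ → (d ∘ κ) p₁ + (d ∘ ι) q₁ < (d ∘ κ) p₃ + (d ∘ ι) q₃ →
      x p₁ q₁ + x p₄ q₄ ≤ x p₂ q₂ + x p₃ q₃ := by
    intro p₁ q₁ p₂ q₂ p₃ q₃ p₄ q₄ hsum h12 h13
    simp only [Function.comp_apply] at hsum h12 h13
    simp only [hx, hh]
    refine min3_affine_outer_le_inner _ _ _ _ _ _ _ _ _ _ ?_ ?_ ?_
    · have : d (ι q₁) + d (κ p₁) ≤ d (ι q₂) + d (κ p₂) := by omega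
      exact_mod_cast this
    · have : d (ι q₁) + d (κ p₁) ≤ d (ι q₃) + d (κ p₃) := by omega
      exact_mod_cast this
    · have : d (ι q₁) + d (κ p₁) + (d (ι q₄) + d (κ p₄)) = d (ι q₂) + d (κ p₂) + (d (ι q₃) + d (κ p₃)) := by omega
      exact_mod_cast this
  -- Leibniz terms
  have hterm : ∀ σ : Equiv.Perm (Fin 5), v (Equiv.Perm.sign σ • ∏ c, N (σ c) c) = ∏ c, v (N (σ c) c) := by
    intro σ
    rcases Int.units_eq_one_or (Equiv.Perm.sign σ) with h1 | h1
    · rw [h1, one_smul, map_prod]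
    · rw [h1, Units.neg_smul, one_smul, AbsoluteValue.map_neg, map_prod]
  have heq : ∏ c, v (N (Fin.revPerm c) c) = Real.exp (∑ c, x c (Fin.revPerm c)) := by
    rw [Real.exp_sum]
    refine Finset.prod_congr rfl fun c _ => ?_
    have hNrc : N (Fin.revPerm c) c = f.coeff (d (ι (Fin.revPerm c)) + d (κ c)) := by
      rw [hN, Matrix.of_apply, hf, coeff_offdiag_gen_of_sidon d M hsid (hrev_off c)]
    rw [hNrc, hx]
    simp only []
    rw [hhrev c, hℓ]
    simp only []
    rw [Real.exp_log (v.pos (Polynomial.mem_support_iff.1 (hrev_supp c)))]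
  -- every other term is strictly smaller
  have hmax : ∀ σ ∈ (univ : Finset (Equiv.Perm (Fin 5))), σ ≠ Fin.revPerm →
      v (Equiv.Perm.sign σ • ∏ c, N (σ c) c)
        < v (Equiv.Perm.sign (Fin.revPerm : Equiv.Perm (Fin 5)) • ∏ c, N ((Fin.revPerm : Equiv.Perm (Fin 5)) c) c) := by
    intro σ _ hσ
    rw [hterm, hterm, heq]
    by_cases hz : ∃ c, N (σ c) c = 0
    · obtain ⟨c, hc⟩ := hz
      rw [Finset.prod_eq_zero (Finset.mem_univ c) (by rw [hc, map_zero])]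
      exact Real.exp_pos _
    push Not at hz
    have hprod : ∏ c, v (N (σ c) c) = Real.exp (∑ c, Real.log (v (N (σ c) c))) := by
      rw [Real.exp_sum]
      exact Finset.prod_congr rfl fun c _ => (Real.exp_log (v.pos (hz c))).symm
    rw [hprod]
    refine Real.exp_lt_exp.2 ?_
    have hle_c : ∀ c, Real.log (v (N (σ c) c)) ≤ x c (σ c) := fun c =>
      (hent _ _ (hz c)).2.trans (hmaj _ (hent _ _ (hz c)).1)
    obtain ⟨c₀, hc₀⟩ : ∃ c, σ c ≠ Fin.revPerm c := by
      by_contra hno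
      push Not at hno
      exact hσ (Equiv.ext hno)
    have hne3 : d (ι (σ c₀)) + d (κ c₀) ≠ B₀ ∧ d (ι (σ c₀)) + d (κ c₀) ≠ B₁ ∧ d (ι (σ c₀)) + d (κ c₀) ≠ B₂ := by
      refine ⟨fun h0 => hc₀ (hsum_rev _ _ (Or.inl h0)), fun h0 => hc₀ (hsum_rev _ _ (Or.inr (Or.inl h0))),
        fun h0 => hc₀ (hsum_rev _ _ (Or.inr (Or.inr h0)))⟩
    have hlt_c : Real.log (v (N (σ c₀) c₀)) < x c₀ (σ c₀) :=
      (hent _ _ (hz c₀)).2.trans_lt (hmaj_lt _ (hent _ _ (hz c₀)).1 hne3.1 hne3.2.1 hne3.2.2)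
    calc ∑ c, Real.log (v (N (σ c) c)) < ∑ c, x c (σ c) :=
          Finset.sum_lt_sum (fun c _ => hle_c c) ⟨c₀, Finset.mem_univ _, hlt_c⟩
      _ ≤ ∑ c, x c (Fin.revPerm c) := sum_perm_le_sum_rev x (d ∘ κ) (d ∘ ι) hκmono hιmono hconc _ σ le_rfl
  have hsum := abv_sum_eq_of_unique_max v hv (univ : Finset (Equiv.Perm (Fin 5)))
    (fun σ => Equiv.Perm.sign σ • ∏ c, N (σ c) c) (Finset.mem_univ (Fin.revPerm : Equiv.Perm (Fin 5))) hmax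
  rw [← Matrix.det_apply, hdet, map_zero, hterm, heq] at hsum
  exact absurd hsum (ne_of_lt (Real.exp_pos _))

/-! ## §2 Families of pairs without three mutually nested members -/

/-- **no three mutually nested pairs ⇒ at most `(2K − 3) + (2K − 7)` pairs:** the members containing no nested member form a chain
(`card_le_of_pairChain`, gap `0`), the others form a chain of gap `≥ 3` (a nested pair inside and no third around). [elementary] -/
theorem card_le_of_noThreeNested {K : ℕ} (D : Finset (Fin K × Fin K)) (hlt : ∀ p ∈ D, p.1 < p.2)
    (hno3 : ∀ p ∈ D, ∀ p' ∈ D, ∀ q ∈ D, ¬ (p.1 < p'.1 ∧ p'.1 < q.1 ∧ q.2 < p'.2 ∧ p'.2 < p.2)) :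
    D.card ≤ (2 * K - 3) + (2 * K - 7) := by
  set D₁ := D.filter fun p => ¬ ∃ q ∈ D, p.1 < q.1 ∧ q.2 < p.2 with hD₁
  set D₂ := D.filter fun p => ∃ q ∈ D, p.1 < q.1 ∧ q.2 < p.2 with hD₂
  have hsplit : D₂.card + D₁.card = D.card := Finset.card_filter_add_card_filter_not (s := D) _
  have h1 : D₁.card ≤ 2 * K - 3 := by
    have h := card_le_of_pairChain 0 D₁ (fun p hp => by simpa using hlt p (Finset.mem_filter.1 hp).1) ?_
    · simpa using h
    intro p hp p' hp' h1
    by_contra h2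
    push Not at h2
    exact (Finset.mem_filter.1 hp).2 ⟨p', (Finset.mem_filter.1 hp').1, h1, h2⟩
  have h2 : D₂.card ≤ 2 * K - 3 - 2 * 2 := by
    refine card_le_of_pairChain 2 D₂ (fun p hp => ?_) ?_
    · obtain ⟨hpD, q, hqD, hq1, hq2⟩ := Finset.mem_filter.1 hp
      have hq := hlt q hqD
      have h1 : p.1.val < q.1.val := hq1
      have h2 : q.1.val < q.2.val := hq
      have h3 : q.2.val < p.2.val := hq2
      omega
    · intro p hp p' hp' h1
      by_contra h2
      push Not at h2
      obtain ⟨hpD, -⟩ := Finset.mem_filter.1 hp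
      obtain ⟨hp'D, q, hqD, hq1, hq2⟩ := Finset.mem_filter.1 hp'
      exact hno3 p hpD p' hp'D q hqD ⟨h1, hq1, hq2, h2⟩
  omega

/-! ## §3 The general width-two Sidon row for sorted letters -/

/-- **at most `(2K − 3) + (2K − 7) + K` dominant exponents** for a general `2 × 2` Sidon pencil with strictly increasing exponents.
[assembly] -/
theorem domCount_le_of_sidon_sorted_gen (v : AbsoluteValue F ℝ) (hv : IsNonarchimedean v) {K : ℕ} (d : Fin K → ℕ)
    (hd : StrictMono d) (M : Fin K → Matrix (Fin 2) (Fin 2) F)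
    (hsid : ∀ l₁ l₂ l₃ l₄ : Fin K, d l₁ + d l₂ = d l₃ + d l₄ → (l₁ = l₃ ∧ l₂ = l₄) ∨ (l₁ = l₄ ∧ l₂ = l₃)) :
    ((Matrix.det (∑ l, ((X : F[X]) ^ d l) • (M l).map (C : F →+* F[X]))).support.filter fun E =>
        ∃ r : ℝ, 0 < r ∧ ∀ E' ∈ (Matrix.det (∑ l, ((X : F[X]) ^ d l) • (M l).map (C : F →+* F[X]))).support, E' ≠ E →
          v ((Matrix.det (∑ l, ((X : F[X]) ^ d l) • (M l).map (C : F →+* F[X]))).coeff E') * r ^ E'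
            < v ((Matrix.det (∑ l, ((X : F[X]) ^ d l) • (M l).map (C : F →+* F[X]))).coeff E) * r ^ E).card
      ≤ (2 * K - 3) + (2 * K - 7) + K := by
  set f : F[X] := Matrix.det (∑ l, ((X : F[X]) ^ d l) • (M l).map (C : F →+* F[X])) with hf
  set D := f.support.filter fun E => ∃ r : ℝ, 0 < r ∧ ∀ E' ∈ f.support, E' ≠ E →
      v (f.coeff E') * r ^ E' < v (f.coeff E) * r ^ E with hD
  set Doff : Finset (Fin K × Fin K) := (univ : Finset (Fin K × Fin K)).filter fun p => p.1 < p.2 ∧ d p.1 + d p.2 ∈ D with hDoff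
  set Diag : Finset ℕ := (univ : Finset (Fin K)).image fun i => d i + d i with hDiag
  have hcover : D ⊆ Doff.image (fun p => d p.1 + d p.2) ∪ Diag := by
    intro E hE
    have hEsupp : E ∈ f.support := (Finset.mem_filter.1 hE).1
    have hne := Polynomial.mem_support_iff.1 hEsupp
    rw [hf, coeff_det_genPencil_two d M E] at hne
    obtain ⟨p, hp, -⟩ := Finset.exists_ne_zero_of_sum_ne_zero hne
    obtain ⟨-, hpE⟩ := Finset.mem_filter.1 hp
    rw [Finset.mem_union]
    rcases lt_trichotomy p.1 p.2 with h | h | h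
    · left
      refine Finset.mem_image.2 ⟨(p.1, p.2), Finset.mem_filter.2 ⟨Finset.mem_univ _, h, ?_⟩, hpE⟩
      rw [hpE]; exact hE
    · right
      exact Finset.mem_image.2 ⟨p.1, Finset.mem_univ _, by rw [← hpE, h]⟩
    · left
      refine Finset.mem_image.2 ⟨(p.2, p.1), Finset.mem_filter.2 ⟨Finset.mem_univ _, h, ?_⟩, by rw [← hpE, Nat.add_comm]⟩
      show d p.2 + d p.1 ∈ D
      rw [Nat.add_comm, hpE]; exact hE
  have hno3 : ∀ p ∈ Doff, ∀ p' ∈ Doff, ∀ q ∈ Doff, ¬ (p.1 < p'.1 ∧ p'.1 < q.1 ∧ q.2 < p'.2 ∧ p'.2 < p.2) := by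
    intro p hp p' hp' q hq hnest
    obtain ⟨-, -, hpD⟩ := Finset.mem_filter.1 hp
    obtain ⟨-, -, hp'D⟩ := Finset.mem_filter.1 hp'
    obtain ⟨-, hq12, hqD⟩ := Finset.mem_filter.1 hq
    refine not_three_nested_dominant_gen_of_sidon v hv d M hsid (hd hnest.1) (hd hnest.2.1) (hd hq12) (hd hnest.2.2.1)
      (hd hnest.2.2.2) fun E hE => ?_
    simp only [Finset.mem_insert, Finset.mem_singleton] at hE
    rcases hE with rfl | rfl | rfl
    · exact Finset.mem_filter.1 hpD
    · exact Finset.mem_filter.1 hp'D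
    · exact Finset.mem_filter.1 hqD
  have hoff : Doff.card ≤ (2 * K - 3) + (2 * K - 7) :=
    card_le_of_noThreeNested Doff (fun p hp => (Finset.mem_filter.1 hp).2.1) hno3
  have hdiag : Diag.card ≤ K := Finset.card_image_le.trans (by rw [Finset.card_univ, Fintype.card_fin])
  calc D.card ≤ (Doff.image (fun p => d p.1 + d p.2) ∪ Diag).card := Finset.card_le_card hcover
    _ ≤ (Doff.image fun p => d p.1 + d p.2).card + Diag.card := Finset.card_union_le _ _
    _ ≤ Doff.card + K := Nat.add_le_add (Finset.card_image_le) hdiag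
    _ ≤ (2 * K - 3) + (2 * K - 7) + K := Nat.add_le_add_right hoff K

/-! ## §4 The general width-two Sidon row, unfolded -/

/-- **THE GENERAL WIDTH-TWO SIDON ROW, UNFOLDED:** over a field of characteristic zero with a non-archimedean absolute value, every `2 × 2`
lacunary pencil `Σ_l X^{d_l} M_l` (ARBITRARY letters) with `K ≥ 4` letters on a SIDON support has `npEdges ≤ 5K − 11` (binders of
`GenValRootLawAt 2 K (5 * K - 11)` plus the Sidon hypothesis; `K = 4, 5`: the trivial `9, 14`; content from `K = 6`).
[three-nested exclusion + two chains] -/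
theorem valGenSidonTwo_unfolded :
    ∀ (F : Type) [Field F] [CharZero F] (v : AbsoluteValue F ℝ), IsNonarchimedean v →
      ∀ (K : ℕ), 4 ≤ K → ∀ (d : Fin K → ℕ) (M : Fin K → Matrix (Fin 2) (Fin 2) F),
        (∀ l₁ l₂ l₃ l₄ : Fin K, d l₁ + d l₂ = d l₃ + d l₄ → (l₁ = l₃ ∧ l₂ = l₄) ∨ (l₁ = l₄ ∧ l₂ = l₃)) →
        ((Matrix.det (∑ l, ((Polynomial.X : Polynomial F) ^ d l) • (M l).map Polynomial.C)).support.filter fun E =>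
            ∃ r : ℝ, 0 < r ∧ ∀ E' ∈ (Matrix.det (∑ l, ((Polynomial.X : Polynomial F) ^ d l) • (M l).map Polynomial.C)).support,
              E' ≠ E →
              v ((Matrix.det (∑ l, ((Polynomial.X : Polynomial F) ^ d l) • (M l).map Polynomial.C)).coeff E') * r ^ E'
                < v ((Matrix.det (∑ l, ((Polynomial.X : Polynomial F) ^ d l) • (M l).map Polynomial.C)).coeff E) * r ^ E).card - 1
          ≤ 5 * K - 11 := by
  intro F _ _ v hv K hK d M hsid
  have hdinj : Function.Injective d := by
    intro i j hij
    rcases hsid i i i j (by rw [hij]) with ⟨-, h⟩ | ⟨h, -⟩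
    · exact h
    · exact h
  set σ : Equiv.Perm (Fin K) := Tuple.sort d with hσ
  have hmono : StrictMono (d ∘ σ) := (Tuple.monotone_sort d).strictMono_of_injective (hdinj.comp σ.injective)
  have hsid' : ∀ l₁ l₂ l₃ l₄ : Fin K, (d ∘ σ) l₁ + (d ∘ σ) l₂ = (d ∘ σ) l₃ + (d ∘ σ) l₄ →
      (l₁ = l₃ ∧ l₂ = l₄) ∨ (l₁ = l₄ ∧ l₂ = l₃) := by
    intro l₁ l₂ l₃ l₄ h
    rcases hsid _ _ _ _ h with ⟨h1, h2⟩ | ⟨h1, h2⟩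
    · exact Or.inl ⟨σ.injective h1, σ.injective h2⟩
    · exact Or.inr ⟨σ.injective h1, σ.injective h2⟩
  have hf' : Matrix.det (∑ l, ((X : F[X]) ^ (d ∘ σ) l) • (M (σ l)).map (C : F →+* F[X]))
      = Matrix.det (∑ l, ((X : F[X]) ^ d l) • (M l).map (C : F →+* F[X])) :=
    congrArg Matrix.det (Equiv.sum_comp σ (fun l => ((X : F[X]) ^ d l) • (M l).map (C : F →+* F[X])))
  have h := domCount_le_of_sidon_sorted_gen v hv (d ∘ σ) hmono (fun l => M (σ l)) hsid'
  rw [hf'] at h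
  omega

end Summit.ValiantsHypothesis.ValiantsHypothesis.Theorems.KPlusLogSqLaw.ValDoor
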